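import Mathlib.Analysis.RCLike.Basic
import HarnessLib

/-!
# Enclosures of symmetric and Hermitian quadratic forms (Gershgorin / `L D Lᵀ` residual bounds)

Topic `Literature/Analysis/ValidatedNumerics`. The ALGEBRAIC core of the tree's generic
eigen-enclosure certificates (`SymmetricEigenCertificate.lean`, same directory): everything a
kernel-checked certificate needs to turn finitely many rational inequalities into a bound
`λ · ‖x‖² ≤ xᵀ A x` valid for EVERY real matrix `A` of an interval family `|A − C| ≤ Δ`
(entrywise), and the reduction of complex (more generally `RCLike`) Hermitian forms to real
quadratic forms of twice the size. Matrices and vectors are plain functions `ℕ → ℕ → ℝ`,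
`ℕ → ℝ` restricted to `Finset.range n` — the format in which list-tabulated certificate data is
read (`WeilPositivityAlgebra.lean` uses the same convention). Everything here is proved; there
are no definitions of notions beyond the bookkeeping ones below and no named facts.

## Contents

* `quadForm n A x = Σ_{i,j<n} A i j · x i x j`, `sqSum n x = Σ_{i<n} x i²`,
  `offDiag n A i = Σ_{j<n, j≠i} (|A i j| + |A j i|)/2` (symmetrised Gershgorin radius),
  `radRow n Δ i = Σ_{j<n} (Δ i j + Δ j i)/2`, `ldlt k L D i j = Σ_{m<k} L i m · D m · L j m`,
  `residual k C L D lam i j = C i j − ldlt k L D i j − lam·δ_{ij}`.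
* **Gershgorin minorant** `sum_diag_sub_offDiag_mul_sq_le`:
  `Σ_i (A i i − offDiag n A i) x i² ≤ quadForm n A x` (no symmetry assumed), and
  `mul_sqSum_le_quadForm_of_le_diag_sub_offDiag` (`c ≤ A i i − offDiag ⇒ c‖x‖² ≤ xᵀAx`).
* `quadForm_ldlt`, `quadForm_ldlt_nonneg`: `xᵀ (L D Lᵀ) x = Σ_m D m (Σ_i L i m x i)² ≥ 0` for
  `D ≥ 0` (rectangular `L`, `k` columns; `D = 1` is the Gram/Cholesky case `UᵀU`).
* **Main lower bound** `mul_sqSum_le_quadForm_of_residual`: if `D ≥ 0`, `|A − C| ≤ Δ` on the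
  block and `offDiag n R i + radRow n Δ i ≤ R i i` for all `i < n`, `R = residual k C L D lam`,
  then `lam · sqSum n x ≤ quadForm n A x` for all `x`.
* **Test-vector (Rayleigh) bounds** `quadForm_le_quadForm_add_rad`, `quadForm_sub_rad_le_quadForm`:
  `|xᵀ A x − xᵀ C x| ≤ Σ_{i,j} Δ i j |x i| |x j|`.
* **Real embedding of Hermitian forms** (`𝕜` any `RCLike` field): `realEmb n H`, `realVec n z`
  (the `2n × 2n` real matrix `[[Re H, −Im H], [Im H, Re H]]` and the vector `(Re z, Im z)`),
  `re_hermForm_eq_quadForm`: `re (Σ conj(z i) H i j z j) = quadForm (2n) (realEmb n H) (realVec n z)`,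
  `sqSum_realVec`: `sqSum (2n) (realVec n z) = Σ ‖z i‖²`, and `abs_realEmb_sub_le`: entrywise
  radii transfer (`‖H i j − G i j‖ ≤ Δ i j ⇒ |realEmb H − realEmb G| ≤ realRad Δ`).

## References

* S. Gershgorin, *Über die Abgrenzung der Eigenwerte einer Matrix*, Izv. Akad. Nauk SSSR (1931)
  — the row-sum bound; here in quadratic-form (symmetrised) form. [folklore]
* S. M. Rump, *Verification methods: rigorous results using floating-point arithmetic*, Acta
  Numerica 19 (2010), §10.8 (rounded Cholesky/`LDLᵀ` factor plus a bound on the residual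
  certifies positive definiteness of all matrices of an interval family). [folklore]
-/

noncomputable section

open Finset
open scoped BigOperators

namespace Literature.Analysis.ValidatedNumerics

/-! ### Quadratic forms on `range n` -/

/-- The real quadratic form `xᵀ A x = Σ_{i,j<n} A i j · (x i · x j)` of an `ℕ`-indexed matrix on its
leading `n × n` block. [folklore] -/
def quadForm (n : ℕ) (A : ℕ → ℕ → ℝ) (x : ℕ → ℝ) : ℝ :=
  ∑ i ∈ range n, ∑ j ∈ range n, A i j * (x i * x j)

/-- `Σ_{i<n} (x i)²`, the squared Euclidean norm of the leading block of `x`. [folklore] -/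
def sqSum (n : ℕ) (x : ℕ → ℝ) : ℝ := ∑ i ∈ range n, x i ^ 2

/-- The symmetrised Gershgorin radius `Σ_{j<n, j≠i} (|A i j| + |A j i|)/2` of row/column `i`.
[folklore] -/
def offDiag (n : ℕ) (A : ℕ → ℕ → ℝ) (i : ℕ) : ℝ :=
  ∑ j ∈ range n, if j = i then 0 else (|A i j| + |A j i|) / 2

/-- The symmetrised row sum `Σ_{j<n} (Δ i j + Δ j i)/2` of a radius matrix (diagonal included).
[folklore] -/
def radRow (n : ℕ) (Δ : ℕ → ℕ → ℝ) (i : ℕ) : ℝ := ∑ j ∈ range n, (Δ i j + Δ j i) / 2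

/-- The matrix `L · diag D · Lᵀ` of a factor `L` with `k` columns and weights `D`:
`Σ_{m<k} L i m · D m · L j m`. [folklore] -/
def ldlt (k : ℕ) (L : ℕ → ℕ → ℝ) (D : ℕ → ℝ) (i j : ℕ) : ℝ := ∑ m ∈ range k, L i m * D m * L j m

/-- The residual `R = C − L D Lᵀ − lam · I` of an `LDLᵀ` certificate for the shifted centre matrix.
[folklore] -/
def residual (k : ℕ) (C L : ℕ → ℕ → ℝ) (D : ℕ → ℝ) (lam : ℝ) (i j : ℕ) : ℝ :=
  C i j - ldlt k L D i j - if i = j then lam else 0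

variable {n : ℕ}

/-- `quadForm` of a pointwise sum. [folklore] -/
theorem quadForm_add (n : ℕ) (A B : ℕ → ℕ → ℝ) (x : ℕ → ℝ) :
    quadForm n (fun i j ↦ A i j + B i j) x = quadForm n A x + quadForm n B x := by
  unfold quadForm
  rw [← sum_add_distrib]
  refine sum_congr rfl fun i _ ↦ ?_
  rw [← sum_add_distrib]
  exact sum_congr rfl fun j _ ↦ by ring

/-- `quadForm` of a pointwise difference. [folklore] -/
theorem quadForm_sub (n : ℕ) (A B : ℕ → ℕ → ℝ) (x : ℕ → ℝ) :
    quadForm n (fun i j ↦ A i j - B i j) x = quadForm n A x - quadForm n B x := by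
  unfold quadForm
  rw [← sum_sub_distrib]
  refine sum_congr rfl fun i _ ↦ ?_
  rw [← sum_sub_distrib]
  exact sum_congr rfl fun j _ ↦ by ring

/-- The quadratic form of `lam · I` is `lam · sqSum`. [folklore] -/
theorem quadForm_diagonal_const (n : ℕ) (lam : ℝ) (x : ℕ → ℝ) :
    quadForm n (fun i j ↦ if i = j then lam else 0) x = lam * sqSum n x := by
  unfold quadForm sqSum
  rw [mul_sum]
  refine sum_congr rfl fun i hi ↦ ?_
  simp only [ite_mul, zero_mul, sum_ite_eq, hi, ↓reduceIte]
  ring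

/-- `sqSum` is non-negative. [folklore] -/
theorem sqSum_nonneg (n : ℕ) (x : ℕ → ℝ) : 0 ≤ sqSum n x :=
  sum_nonneg fun i _ ↦ sq_nonneg (x i)

/-! ### The Gershgorin minorant -/

/-- **Gershgorin minorant of a quadratic form** (no symmetry assumed):
`Σ_{i<n} (A i i − offDiag n A i) · x i² ≤ xᵀ A x`, from `A i j x i x j ≥ −|A i j|(x i² + x j²)/2`.
[folklore] -/
theorem sum_diag_sub_offDiag_mul_sq_le (n : ℕ) (A : ℕ → ℕ → ℝ) (x : ℕ → ℝ) :
    ∑ i ∈ range n, (A i i - offDiag n A i) * x i ^ 2 ≤ quadForm n A x := by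
  -- termwise lower bound
  have h1 : ∀ i j, (if j = i then A i i * x i ^ 2 else -(|A i j| * (x i ^ 2 + x j ^ 2) / 2)) ≤
      A i j * (x i * x j) := by
    intro i j
    split_ifs with hij
    · subst hij; rw [sq]
    · have h := neg_abs_le (A i j * (x i * x j))
      rw [abs_mul, abs_mul] at h
      nlinarith [two_mul_le_add_sq (|x i|) (|x j|), abs_nonneg (A i j), sq_abs (x i), sq_abs (x j),
        abs_nonneg (x i), abs_nonneg (x j)]
  have h2 : ∑ i ∈ range n, ∑ j ∈ range n,
      (if j = i then A i i * x i ^ 2 else -(|A i j| * (x i ^ 2 + x j ^ 2) / 2)) ≤ quadForm n A x :=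
    sum_le_sum fun i _ ↦ sum_le_sum fun j _ ↦ h1 i j
  refine le_trans (le_of_eq ?_) h2
  -- evaluate the minorant
  have h3 : ∑ i ∈ range n, ∑ j ∈ range n,
      (if j = i then A i i * x i ^ 2 else -(|A i j| * (x i ^ 2 + x j ^ 2) / 2)) =
      ∑ i ∈ range n, (A i i * x i ^ 2 -
        ∑ j ∈ range n, (if j = i then 0 else |A i j| * x i ^ 2 / 2)) -
      ∑ i ∈ range n, ∑ j ∈ range n, (if j = i then 0 else |A i j| * x j ^ 2 / 2) := by
    rw [← sum_sub_distrib]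
    refine sum_congr rfl fun i hi ↦ ?_
    have e1 : ∀ j, (if j = i then A i i * x i ^ 2 else -(|A i j| * (x i ^ 2 + x j ^ 2) / 2)) =
        (if j = i then A i i * x i ^ 2 else 0) - (if j = i then 0 else |A i j| * x i ^ 2 / 2) -
          (if j = i then 0 else |A i j| * x j ^ 2 / 2) := fun j ↦ by
      split_ifs <;> ring
    simp_rw [e1]
    rw [sum_sub_distrib, sum_sub_distrib, sum_ite_eq', if_pos hi]
  have h4 : ∑ i ∈ range n, ∑ j ∈ range n, (if j = i then 0 else |A i j| * x j ^ 2 / 2) =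
      ∑ i ∈ range n, ∑ j ∈ range n, (if j = i then 0 else |A j i| * x i ^ 2 / 2) := by
    rw [sum_comm]
    refine sum_congr rfl fun i _ ↦ sum_congr rfl fun j _ ↦ ?_
    by_cases h : i = j
    · subst h; simp
    · rw [if_neg h, if_neg (Ne.symm h)]
  rw [h3, h4, ← sum_sub_distrib]
  refine sum_congr rfl fun i _ ↦ ?_
  unfold offDiag
  rw [sub_mul, sub_sub, ← sum_add_distrib, sum_mul]
  congr 1
  refine sum_congr rfl fun j _ ↦ ?_
  split_ifs <;> ring

/-- **Gershgorin lower bound of a quadratic form**: if `c ≤ A i i − offDiag n A i` for every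
`i < n` then `c · ‖x‖² ≤ xᵀ A x`. [folklore] -/
theorem mul_sqSum_le_quadForm_of_le_diag_sub_offDiag {n : ℕ} {A : ℕ → ℕ → ℝ} {c : ℝ}
    (h : ∀ i ∈ range n, c ≤ A i i - offDiag n A i) (x : ℕ → ℝ) :
    c * sqSum n x ≤ quadForm n A x := by
  refine le_trans ?_ (sum_diag_sub_offDiag_mul_sq_le n A x)
  unfold sqSum
  rw [mul_sum]
  exact sum_le_sum fun i hi ↦ mul_le_mul_of_nonneg_right (h i hi) (sq_nonneg _)

/-- Monotonicity of the Gershgorin data under an entrywise perturbation bound: if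
`|M i j| ≤ |R i j| + Δ i j` on the block then `offDiag n M i + Δ i i ≤ offDiag n R i + radRow n Δ i`.
[folklore] -/
theorem offDiag_add_le_of_abs_le {n : ℕ} {M R Δ : ℕ → ℕ → ℝ}
    (h : ∀ i ∈ range n, ∀ j ∈ range n, |M i j| ≤ |R i j| + Δ i j) {i : ℕ} (hi : i ∈ range n) :
    offDiag n M i + Δ i i ≤ offDiag n R i + radRow n Δ i := by
  unfold offDiag radRow
  have e : Δ i i = ∑ j ∈ range n, if j = i then Δ i i else 0 := by rw [sum_ite_eq', if_pos hi]
  rw [e, ← sum_add_distrib, ← sum_add_distrib]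
  refine sum_le_sum fun j hj ↦ ?_
  split_ifs with hji
  · subst hji; linarith
  · have h1 := h i hi j hj
    have h2 := h j hj i hi
    linarith

/-- `offDiag` only reads the leading block. [folklore] -/
theorem offDiag_congr {n : ℕ} {M R : ℕ → ℕ → ℝ} (h : ∀ i < n, ∀ j < n, M i j = R i j) {i : ℕ}
    (hi : i < n) : offDiag n M i = offDiag n R i := by
  unfold offDiag
  refine sum_congr rfl fun j hj ↦ ?_
  rw [h i hi j (mem_range.1 hj), h j (mem_range.1 hj) i hi]

/-- `quadForm` only reads the leading blocks. [folklore] -/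
theorem quadForm_congr {n : ℕ} {A B : ℕ → ℕ → ℝ} {x y : ℕ → ℝ} (hA : ∀ i < n, ∀ j < n, A i j = B i j)
    (hx : ∀ i < n, x i = y i) : quadForm n A x = quadForm n B y := by
  unfold quadForm
  refine sum_congr rfl fun i hi ↦ sum_congr rfl fun j hj ↦ ?_
  rw [hA i (mem_range.1 hi) j (mem_range.1 hj), hx i (mem_range.1 hi), hx j (mem_range.1 hj)]

/-- `sqSum` only reads the leading block. [folklore] -/
theorem sqSum_congr {n : ℕ} {x y : ℕ → ℝ} (hx : ∀ i < n, x i = y i) : sqSum n x = sqSum n y := by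
  unfold sqSum
  exact sum_congr rfl fun i hi ↦ by rw [hx i (mem_range.1 hi)]

/-! ### `L D Lᵀ` is positive semidefinite for `D ≥ 0` -/

/-- `xᵀ (L D Lᵀ) x = Σ_{m<k} D m · (Σ_{i<n} L i m x i)²`. [folklore] -/
theorem quadForm_ldlt (n k : ℕ) (L : ℕ → ℕ → ℝ) (D : ℕ → ℝ) (x : ℕ → ℝ) :
    quadForm n (ldlt k L D) x = ∑ m ∈ range k, D m * (∑ i ∈ range n, L i m * x i) ^ 2 := by
  unfold quadForm ldlt
  calc ∑ i ∈ range n, ∑ j ∈ range n, (∑ m ∈ range k, L i m * D m * L j m) * (x i * x j)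
      = ∑ i ∈ range n, ∑ j ∈ range n, ∑ m ∈ range k, L i m * D m * L j m * (x i * x j) := by
        simp_rw [sum_mul]
    _ = ∑ i ∈ range n, ∑ m ∈ range k, ∑ j ∈ range n, L i m * D m * L j m * (x i * x j) :=
        sum_congr rfl fun i _ ↦ sum_comm
    _ = ∑ m ∈ range k, ∑ i ∈ range n, ∑ j ∈ range n, L i m * D m * L j m * (x i * x j) :=
        sum_comm
    _ = ∑ m ∈ range k, D m * (∑ i ∈ range n, L i m * x i) ^ 2 := by
        refine sum_congr rfl fun m _ ↦ ?_
        rw [sq, sum_mul_sum, mul_sum]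
        refine sum_congr rfl fun i _ ↦ ?_
        rw [mul_sum]
        refine sum_congr rfl fun j _ ↦ ?_
        ring

/-- `xᵀ (L D Lᵀ) x ≥ 0` when `D m ≥ 0` for all `m < k`. [folklore] -/
theorem quadForm_ldlt_nonneg {n k : ℕ} {L : ℕ → ℕ → ℝ} {D : ℕ → ℝ}
    (hD : ∀ m ∈ range k, 0 ≤ D m) (x : ℕ → ℝ) : 0 ≤ quadForm n (ldlt k L D) x := by
  rw [quadForm_ldlt]
  exact sum_nonneg fun m hm ↦ mul_nonneg (hD m hm) (sq_nonneg _)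

/-! ### The main lower bound -/

/-- **Lower bound of an interval family of quadratic forms from an `LDLᵀ` residual certificate.**
Let `D ≥ 0`, let `A` be any real matrix with `|A i j − C i j| ≤ Δ i j` for `i, j < n`, and let
`R = C − L D Lᵀ − lam · I`. If `offDiag n R i + radRow n Δ i ≤ R i i` for every `i < n`, then
`lam · Σ x i² ≤ xᵀ A x` for every `x`. (Write `A − L D Lᵀ − lam I = R + (A − C)`; its Gershgorin
data are within `Δ` of those of `R`; add `xᵀ L D Lᵀ x ≥ 0`.) [folklore] -/
theorem mul_sqSum_le_quadForm_of_residual {n k : ℕ} {A C Δ L : ℕ → ℕ → ℝ} {D : ℕ → ℝ} {lam : ℝ}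
    (hD : ∀ m ∈ range k, 0 ≤ D m)
    (hΔ : ∀ i ∈ range n, ∀ j ∈ range n, |A i j - C i j| ≤ Δ i j)
    (hdom : ∀ i ∈ range n,
      offDiag n (residual k C L D lam) i + radRow n Δ i ≤ residual k C L D lam i i)
    (x : ℕ → ℝ) : lam * sqSum n x ≤ quadForm n A x := by
  set R := residual k C L D lam with hR
  set M : ℕ → ℕ → ℝ := fun i j ↦ A i j - ldlt k L D i j - if i = j then lam else 0 with hM
  -- decomposition of the form
  have hdec : quadForm n A x = quadForm n M x + quadForm n (ldlt k L D) x + lam * sqSum n x := by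
    rw [← quadForm_diagonal_const, ← quadForm_add, ← quadForm_add]
    unfold quadForm
    refine sum_congr rfl fun i _ ↦ sum_congr rfl fun j _ ↦ ?_
    simp only [hM]
    ring
  -- entrywise comparison of `M` with `R`
  have hMR : ∀ i ∈ range n, ∀ j ∈ range n, |M i j| ≤ |R i j| + Δ i j := by
    intro i hi j hj
    have e : M i j = R i j + (A i j - C i j) := by simp only [hM, hR, residual]; ring
    rw [e]
    exact (abs_add_le _ _).trans (by linarith [hΔ i hi j hj])
  have hMd : ∀ i ∈ range n, R i i - Δ i i ≤ M i i := by
    intro i hi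
    have e : M i i = R i i + (A i i - C i i) := by simp only [hM, hR, residual]; ring
    rw [e]
    linarith [neg_abs_le (A i i - C i i), hΔ i hi i hi]
  -- Gershgorin on `M`
  have hM0 : 0 * sqSum n x ≤ quadForm n M x := by
    refine mul_sqSum_le_quadForm_of_le_diag_sub_offDiag (fun i hi ↦ ?_) x
    have h1 := offDiag_add_le_of_abs_le hMR hi
    linarith [hdom i hi, hMd i hi]
  rw [zero_mul] at hM0
  rw [hdec]
  linarith [quadForm_ldlt_nonneg (n := n) (L := L) hD x]

/-- The special case without a factor (`k = 0`: pure Gershgorin on the shifted interval family):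
if `offDiag n (C − lam I) i + radRow n Δ i ≤ C i i − lam` for all `i < n` then `lam‖x‖² ≤ xᵀ A x` for
every `A` with `|A − C| ≤ Δ`. [folklore] -/
theorem mul_sqSum_le_quadForm_of_gershgorin {n : ℕ} {A C Δ : ℕ → ℕ → ℝ} {lam : ℝ}
    (hΔ : ∀ i ∈ range n, ∀ j ∈ range n, |A i j - C i j| ≤ Δ i j)
    (hdom : ∀ i ∈ range n, offDiag n C i + radRow n Δ i ≤ C i i - lam)
    (x : ℕ → ℝ) : lam * sqSum n x ≤ quadForm n A x := by
  refine mul_sqSum_le_quadForm_of_residual (k := 0) (L := fun _ _ ↦ 0) (D := fun _ ↦ 0)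
    (fun m hm ↦ le_rfl) hΔ (fun i hi ↦ ?_) x
  have e1 : residual 0 C (fun _ _ ↦ 0) (fun _ ↦ 0) lam i i = C i i - lam := by
    simp [residual, ldlt]
  have e2 : offDiag n (residual 0 C (fun _ _ ↦ 0) (fun _ ↦ 0) lam) i = offDiag n C i := by
    unfold offDiag
    refine sum_congr rfl fun j _ ↦ ?_
    split_ifs with hji
    · rfl
    · simp [residual, ldlt, hji, Ne.symm hji]
  rw [e1, e2]
  exact hdom i hi

/-! ### Test-vector (Rayleigh) bounds -/

/-- **Upper perturbation bound**: if `|A i j − C i j| ≤ Δ i j` on the block then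
`xᵀ A x ≤ xᵀ C x + Σ_{i,j<n} Δ i j |x i| |x j|`. [folklore] -/
theorem quadForm_le_quadForm_add_rad {n : ℕ} {A C Δ : ℕ → ℕ → ℝ}
    (hΔ : ∀ i ∈ range n, ∀ j ∈ range n, |A i j - C i j| ≤ Δ i j) (x : ℕ → ℝ) :
    quadForm n A x ≤ quadForm n C x + ∑ i ∈ range n, ∑ j ∈ range n, Δ i j * (|x i| * |x j|) := by
  have e : quadForm n A x = quadForm n C x + quadForm n (fun i j ↦ A i j - C i j) x := by
    rw [quadForm_sub]; ring
  rw [e, add_le_add_iff_left]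
  unfold quadForm
  refine sum_le_sum fun i hi ↦ sum_le_sum fun j hj ↦ ?_
  calc (A i j - C i j) * (x i * x j) ≤ |(A i j - C i j) * (x i * x j)| := le_abs_self _
    _ = |A i j - C i j| * (|x i| * |x j|) := by rw [abs_mul, abs_mul]
    _ ≤ Δ i j * (|x i| * |x j|) := mul_le_mul_of_nonneg_right (hΔ i hi j hj) (by positivity)

/-- **Lower perturbation bound**: if `|A i j − C i j| ≤ Δ i j` on the block then
`xᵀ C x − Σ_{i,j<n} Δ i j |x i| |x j| ≤ xᵀ A x`. [folklore] -/
theorem quadForm_sub_rad_le_quadForm {n : ℕ} {A C Δ : ℕ → ℕ → ℝ}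
    (hΔ : ∀ i ∈ range n, ∀ j ∈ range n, |A i j - C i j| ≤ Δ i j) (x : ℕ → ℝ) :
    quadForm n C x - ∑ i ∈ range n, ∑ j ∈ range n, Δ i j * (|x i| * |x j|) ≤ quadForm n A x := by
  have hΔ' : ∀ i ∈ range n, ∀ j ∈ range n, |C i j - A i j| ≤ Δ i j := fun i hi j hj ↦ by
    rw [abs_sub_comm]; exact hΔ i hi j hj
  linarith [quadForm_le_quadForm_add_rad hΔ' x]

/-! ### Hermitian forms over an `RCLike` field as real quadratic forms of twice the size -/

section RCLike

variable {𝕜 : Type*} [RCLike 𝕜]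

/-- The real `2n × 2n` embedding `[[Re H, −Im H], [Im H, Re H]]` of an `ℕ`-indexed matrix over an
`RCLike` field (indices `< n`: real parts; indices `n ≤ · < 2n`: imaginary parts). [folklore] -/
def realEmb (n : ℕ) (H : ℕ → ℕ → 𝕜) (i j : ℕ) : ℝ :=
  if i < n then (if j < n then RCLike.re (H i j) else -RCLike.im (H i (j - n)))
  else (if j < n then RCLike.im (H (i - n) j) else RCLike.re (H (i - n) (j - n)))

/-- The real vector `(Re z, Im z)` of length `2n` of an `ℕ`-indexed vector over an `RCLike` field.
[folklore] -/
def realVec (n : ℕ) (z : ℕ → 𝕜) (i : ℕ) : ℝ :=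
  if i < n then RCLike.re (z i) else RCLike.im (z (i - n))

/-- The entrywise radius matrix of the real embedding: `Δ` repeated in the four blocks. [folklore] -/
def realRad (n : ℕ) (Δ : ℕ → ℕ → ℝ) (i j : ℕ) : ℝ :=
  Δ (if i < n then i else i - n) (if j < n then j else j - n)

omit [RCLike 𝕜] in
/-- A sum over `range (2n)` splits into the two halves. [folklore] -/
theorem sum_range_two_mul_eq_add {β : Type*} [AddCommMonoid β] (n : ℕ) (f : ℕ → β) :
    ∑ i ∈ range (2 * n), f i = ∑ i ∈ range n, f i + ∑ i ∈ range n, f (n + i) := by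
  rw [two_mul, sum_range_add]

/-- `sqSum (2n) (realVec n z) = Σ_{i<n} ‖z i‖²`. [folklore] -/
theorem sqSum_realVec (n : ℕ) (z : ℕ → 𝕜) :
    sqSum (2 * n) (realVec n z) = ∑ i ∈ range n, ‖z i‖ ^ 2 := by
  unfold sqSum
  rw [sum_range_two_mul_eq_add, ← sum_add_distrib]
  refine sum_congr rfl fun i hi ↦ ?_
  have hi' : i < n := mem_range.1 hi
  have hni : ¬ (n + i < n) := by omega
  simp only [realVec, hi', hni, ↓reduceIte, Nat.add_sub_cancel_left, RCLike.norm_sq_eq_def]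
  ring

/-- **Hermitian forms as real quadratic forms**: for any matrix `H` and vector `z` over an `RCLike`
field, `re (Σ_{i,j<n} conj(z i) · H i j · z j) = quadForm (2n) (realEmb n H) (realVec n z)`.
[folklore] -/
theorem re_hermForm_eq_quadForm (n : ℕ) (H : ℕ → ℕ → 𝕜) (z : ℕ → 𝕜) :
    RCLike.re (∑ i ∈ range n, ∑ j ∈ range n, star (z i) * H i j * z j) =
      quadForm (2 * n) (realEmb n H) (realVec n z) := by
  unfold quadForm
  rw [sum_range_two_mul_eq_add]
  simp_rw [sum_range_two_mul_eq_add]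
  rw [← sum_add_distrib, map_sum]
  refine sum_congr rfl fun i hi ↦ ?_
  rw [← sum_add_distrib, ← sum_add_distrib, ← sum_add_distrib, map_sum]
  refine sum_congr rfl fun j hj ↦ ?_
  have hi' : i < n := mem_range.1 hi
  have hj' : j < n := mem_range.1 hj
  have hni : ¬ (n + i < n) := by omega
  have hnj : ¬ (n + j < n) := by omega
  simp only [realEmb, realVec, hi', hj', hni, hnj, ↓reduceIte, Nat.add_sub_cancel_left,
    RCLike.mul_re, RCLike.mul_im, RCLike.star_def, RCLike.conj_re, RCLike.conj_im]
  ring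

/-- Radii transfer to the real embedding: `‖H i j − G i j‖ ≤ Δ i j` for `i, j < n` implies
`|realEmb n H i j − realEmb n G i j| ≤ realRad n Δ i j` for `i, j < 2n`. [folklore] -/
theorem abs_realEmb_sub_le {n : ℕ} {H G : ℕ → ℕ → 𝕜} {Δ : ℕ → ℕ → ℝ}
    (hΔ : ∀ i ∈ range n, ∀ j ∈ range n, ‖H i j - G i j‖ ≤ Δ i j) :
    ∀ i ∈ range (2 * n), ∀ j ∈ range (2 * n),
      |realEmb n H i j - realEmb n G i j| ≤ realRad n Δ i j := by
  intro i hi j hj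
  have hi2 : i < 2 * n := mem_range.1 hi
  have hj2 : j < 2 * n := mem_range.1 hj
  have hre : ∀ w : 𝕜, |RCLike.re w| ≤ ‖w‖ := fun w ↦ RCLike.abs_re_le_norm w
  have him : ∀ w : 𝕜, |RCLike.im w| ≤ ‖w‖ := fun w ↦ RCLike.abs_im_le_norm w
  unfold realEmb realRad
  by_cases hin : i < n <;> by_cases hjn : j < n <;>
    simp only [hin, hjn, ↓reduceIte]
  · exact le_trans (by rw [← map_sub]; exact hre _) (hΔ i (mem_range.2 hin) j (mem_range.2 hjn))
  · have hj' : j - n < n := by omega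
    refine le_trans ?_ (hΔ i (mem_range.2 hin) (j - n) (mem_range.2 hj'))
    rw [show -RCLike.im (H i (j - n)) - -RCLike.im (G i (j - n)) =
      -(RCLike.im (H i (j - n) - G i (j - n))) by rw [map_sub]; ring, abs_neg]
    exact him _
  · have hi' : i - n < n := by omega
    refine le_trans ?_ (hΔ (i - n) (mem_range.2 hi') j (mem_range.2 hjn))
    rw [← map_sub]
    exact him _
  · have hi' : i - n < n := by omega
    have hj' : j - n < n := by omega
    refine le_trans ?_ (hΔ (i - n) (mem_range.2 hi') (j - n) (mem_range.2 hj'))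
    rw [← map_sub]
    exact hre _

/-- **Lower bound of an interval family of Hermitian forms** (any `RCLike` field): if the real
embedding of the centre `G` carries an `LDLᵀ` residual certificate for the shift `lam` against the
radii `realRad n Δ`, then `lam · Σ ‖z i‖² ≤ re (Σ conj(z i) H i j z j)` for every `H` with
`‖H i j − G i j‖ ≤ Δ i j` (`i, j < n`) and every `z`. [folklore] -/
theorem mul_normSq_le_re_hermForm_of_residual {n k : ℕ} {H G : ℕ → ℕ → 𝕜} {Δ : ℕ → ℕ → ℝ}
    {L : ℕ → ℕ → ℝ} {D : ℕ → ℝ} {lam : ℝ}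
    (hD : ∀ m ∈ range k, 0 ≤ D m)
    (hΔ : ∀ i ∈ range n, ∀ j ∈ range n, ‖H i j - G i j‖ ≤ Δ i j)
    (hdom : ∀ i ∈ range (2 * n),
      offDiag (2 * n) (residual k (realEmb n G) L D lam) i + radRow (2 * n) (realRad n Δ) i ≤
        residual k (realEmb n G) L D lam i i)
    (z : ℕ → 𝕜) :
    lam * ∑ i ∈ range n, ‖z i‖ ^ 2 ≤
      RCLike.re (∑ i ∈ range n, ∑ j ∈ range n, star (z i) * H i j * z j) := by
  rw [re_hermForm_eq_quadForm, ← sqSum_realVec]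
  exact mul_sqSum_le_quadForm_of_residual hD (abs_realEmb_sub_le hΔ) hdom _

end RCLike

end Literature.Analysis.ValidatedNumerics

end
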